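/-
Copyright (c) 2026. All rights reserved.
Released under Apache 2.0 license as described in the file LICENSE.
-/
import Literature.AlgebraicGeometry.Pohlmann1968.MultiquadraticCMFieldPrimitiveNearBentTypes
import Literature.AlgebraicGeometry.Pohlmann1968.WeilTypeCMSubfieldExceptionalClasses
import HarnessLib

/-!
# The exceptional Hodge classes of the simple near-bent `32`-folds are Weil classes: a near-bent CM type of a
# multiquadratic CM field of degree `64` is of Weil type over EXACTLY `16` imaginary quadratic subfields, and for a
# primitive one `dim B¹⁶(A) − dim D¹⁶(A) ≥ 32` in the middle cohomology of every realisation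

SETTING (tree `MultiquadraticCMFieldPrimitiveNearBentTypes`, `MultiquadraticCMFieldNearBentTypes`,
`DegenerateCMTypesMultiquadraticCMField`, `WeilTypeCMSubfieldExceptionalClasses`, `DivisorClassesCMType`).  `K` a CM
field, Galois over `ℚ` with `Gal(K/ℚ)` of exponent `2`, `[K:ℚ] = 2g`; `Φ` a CM type, `m_τ(Φ) = #{φ ∈ Φ : φ|_F = τ}`
its multiplicity over an embedding `τ` of an imaginary quadratic subfield `F ⊆ K`; `Φ` is BALANCED over `F` — `(A_Φ, F)`
is of WEIL TYPE — when `m_τ = m̄_τ` (`= g/2`) for both `τ`.  The tree proved: the rank formula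
`Rank(Φ) + #{F imaginary quadratic : Φ balanced over F} = g + 1` (`cmTypeRank_add_ncard_weilQuadratic_eq`, Dodson's
constant-weight criterion); `Rank(Φ) = g/2 + 1` for near-bent `Φ` (`four_mul_cmTypeRank_sub_one_eq`); Pohlmann's
dictionary `dim Bᵐ(A) − dim Dᵐ(A) = #(pohlmannSets Φ m ∖ pohlmannDivisorSets Φ m)` (White's count,
`finrank_hodgeClassSpan_sub_finrank_divisorClassesSpan`); and the Mumford–Pohlmann mechanism: for a PRIMITIVE `Φ`
balanced over a subfield `k`, the fibre `Δ_τ = {φ : φ|_k = τ}` over a non-real `τ` is a Pohlmann set which is not a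
Pohlmann divisor set (`fibre_mem_pohlmannSets_diff`) — its weight line, a Weil class of `(A, k)`, is an exceptional
Hodge class on every realisation `A`.  By g45-#5/#6 every multiquadratic CM field of degree `64` has PRIMITIVE
near-bent types, whose abelian varieties are simple `32`-folds «carrying a rational `(m,m)`-class outside `Dᵐ(A) ⊗ ℂ`
for some `m`».  THIS FILE says WHICH classes, and in which degree:

> **Theorem** (`four_mul_ncard_weilQuadratic_eq_of_nearBent`; `ncard_weilQuadratic_eq_sixteen_of_nearBent`).  A
> near-bent CM type of a multiquadratic CM field of degree `2g = 4ᵏ⁺¹` is of Weil type over EXACTLY `g/2 = [K:ℚ]/4`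
> imaginary quadratic subfields (`16` of the `32` when `[K:ℚ] = 64`) — the odd characters `χ_F` with `Ŝ_Φ(χ_F) = 0`.
> **Theorem** (`le_finrank_hodgeClassSpan_sub_finrank_divisorClassesSpan_of_nearBent`, THE COUNT).  Let `[K:ℚ] = 64`
> and `Φ` be near-bent with trivial twist stabiliser.  For EVERY realisation `A` of `(K; Φ)` (a simple `32`-fold):
> **`dim B¹⁶(A) ⊗ ℂ − dim D¹⁶(A) ⊗ ℂ ≥ 32`** — the `32` fibres `Δ_{F,τ}` (`F` one of the `16` Weil subfields, `τ` one
> of its two embeddings), pairwise distinct, are Pohlmann sets of degree `16` which are not divisor sets: `32`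
> independent WEIL LINES of exceptional Hodge classes in the MIDDLE cohomology `H³²(A) = H^{16,16}`.
> **Theorem** (`exists_exceptional_sixteen_of_nearBent`).  In particular such `A` carries a rational `(16,16)`-class
> outside `D¹⁶(A) ⊗ ℂ` (the degree left unspecified by `isSimple_and_exists_exceptional_of_natCard_twistStabilizer_eq_one`).
> **Theorem** (`exists_isSimple_weil_exceptional_of_finrank_eq_sixtyFour`).  Every multiquadratic CM field of degree
> `64` has a CM type all of whose abelian varieties are SIMPLE `32`-folds of Weil type over exactly `16` imaginary
> quadratic subfields with `dim B¹⁶ − dim D¹⁶ ≥ 32`; such abelian varieties exist.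

HONEST SCOPE.  Whether these Weil classes are algebraic (the Hodge conjecture for the simple near-bent `32`-folds) is
OPEN and not addressed; the identification of the weight line of `Δ_τ` with Deligne's `⋀_F H¹` is the tree's
(docstring of `WeilTypeCMSubfieldExceptionalClasses`), not re-proved; equality `= 32` is not claimed (other Pohlmann
sets of degree `16` may exist).  B. B. Gordon [Gordon1999HodgeAVSurvey] 5.13 (ii), 9.2.2 (White's count), §9.3;
H. Pohlmann [Pohlmann1968] Thm. 1; B. van Geemen [vanGeemen1994HodgeAV] 4.7 (Weil type), Thm. 4.5; B. Dodson
[Dodson1984] §3.1.1 Theorem (constant weight); T. Kubota [Kubota1965] §4 Lemma 2; C. Carlet [Carlet2020] §6.2.4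
(near-bent: Walsh support of size `2ⁿ⁻¹`).  THEOREMS ONLY: no definition, no named fact, no instance, no `sorry`.

## References

* [Gordon1999HodgeAVSurvey] B. B. Gordon, *A survey of the Hodge conjecture for abelian varieties*, 5.13 (ii), 9.2.2,
  §9.3.
* [Pohlmann1968] H. Pohlmann, *Algebraic cycles on abelian varieties of complex multiplication type*, Ann. of Math.
  88 (1968), Thm. 1.
* [vanGeemen1994HodgeAV] B. van Geemen, *An introduction to the Hodge conjecture for abelian varieties*, LNM 1594
  (1994), 4.7, Thm. 4.5.
* [Dodson1984] B. Dodson, *The structure of Galois groups of CM-fields*, Trans. AMS 283 (1984), §3.1.1 Theorem.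
* [Kubota1965] T. Kubota, *On the field extension by complex multiplication*, Trans. AMS 118 (1965), §4 Lemma 2.
* [Carlet2020] C. Carlet, *Boolean Functions for Cryptography and Coding Theory*, CUP (2020), §6.2.4.
* [Shimura1998] G. Shimura, *Abelian Varieties with Complex Multiplication and Modular Functions*, §8.2 Prop. 26,
  §8.4 Example (1).

## Provenance

Lane `lit-hodgefound` (Track 2, Layer A3/A5), seat `lit-hodgefound-p10` generation 45, row g45-#7; neighbours cited
by name, nothing restated: `MultiquadraticCMFieldPrimitiveNearBentTypes` (g45-#6:
`exists_nearBent_natCard_twistStabilizer_eq_one_of_finrank_eq_sixtyFour`, USED), `MultiquadraticCMFieldNearBentTypes`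
(`four_mul_cmTypeRank_sub_one_eq`, `isSimple_and_exists_exceptional_of_natCard_twistStabilizer_eq_one`, USED),
`DegenerateCMTypesMultiquadraticCMField` (`cmTypeRank_add_ncard_weilQuadratic_eq`, USED),
`WeilTypeCMSubfieldExceptionalClasses` (`fibre_mem_pohlmannSets_diff`, `card_fibre_eq_two_mul`,
`exists_exceptional_of_fibres_balanced`, USED), `DivisorClassesCMType` (`finrank_hodgeClassSpan_sub_finrank_divisorClassesSpan`,
USED), `DegenerateCMTypesAbelianCMFieldCyclicSubfields` (`mem_fixingSubgroup_iff_embOf_comp_eq`,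
`not_mem_fixingSubgroup_iff_embOf_comp_eq_conjugate`), `CosetGermGaloisSetting` (`CMNumbers.index_fixingSubgroup_eq_two`,
`conjGal_not_mem_fixingSubgroup_iff`), `PrimitiveCMTypeSimple` (`isPrimitive_ringEquiv_complex_iff`),
`CMTypeEquivalenceClassesCount` (`pattern_primitive_iff_twistStabilizer_eq_bot`), `CMAbelianVarietyRealisedHolds`
(`exists_isCMTypeRealisation`).
-/

open scoped BigOperators NumberField IsMulCommutative Classical
open NumberField Module CategoryTheory CategoryTheory.Limits IntermediateField

namespace Literature.AlgebraicGeometry.Pohlmann1968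

namespace MultiquadraticNearBentWeil

open scoped Literature.NumberTheory.ComplexMultiplication
open Literature.NumberTheory.ComplexMultiplication (twistStabilizer IsCMTypeWith conjGal IsPrimitive
  pattern_primitive_iff_twistStabilizer_eq_bot)
open Literature.NumberTheory.ComplexMultiplication.CMNumbers (index_fixingSubgroup_eq_two conjGal_not_mem_fixingSubgroup_iff)
open Literature.AlgebraicGeometry.Pohlmann1968.AbelianKernels (mem_fixingSubgroup_iff_embOf_comp_eq
  not_mem_fixingSubgroup_iff_embOf_comp_eq_conjugate)
open Literature.AlgebraicGeometry.Pohlmann1968.MultiquadraticNearBent (four_mul_cmTypeRank_sub_one_eq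
  isSimple_and_exists_exceptional_of_natCard_twistStabilizer_eq_one cmTypeRank_eq_seventeen_of_finrank_eq_sixtyFour)
open Literature.AlgebraicGeometry.Pohlmann1968.MultiquadraticPrimitiveNearBent
  (exists_nearBent_natCard_twistStabilizer_eq_one_of_finrank_eq_sixtyFour)
open Literature.AlgebraicGeometry.Motives (CMType AbelianVariety)
open Literature.AlgebraicGeometry.HodgeTheory
open Literature.AlgebraicGeometry.VanGeemen1994 (hodgeClassSpan)
open Literature.Barriers.HodgeConjecture (divisorClassesSpan)
open Literature.AlgebraicGeometry.ComplexMultiplication (IsCMTypeRealisation exists_isCMTypeRealisation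
  isPrimitive_ringEquiv_complex_iff)

variable {K : Type} [Field K] [NumberField K] [IsCMField K] [IsGalois ℚ K]
  {A : AbelianVariety ℂ} {ι : 𝓞 K →+* End A} {θ : K →+* Module.End ℂ (complexBetti A.X 1)}

/-! ## §0 Helpers: primitivity, the fibres over an imaginary quadratic subfield as images of cosets -/

section Helpers

omit [IsCMField K] in
/-- `Stab(Φ) = ⊥` ⟹ `Φ` is primitive in the `Aut(ℂ)`-sense (tree dictionary). [cite: Shimura1998, §8.2 Prop. 26] -/
private theorem isPrimitive_of_bot_nw (Φ : CMType K) (hbot : twistStabilizer Φ = ⊥) (φ₀ : K →+* ℂ) :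
    IsPrimitive (ℂ ≃+* ℂ) Φ.1 φ₀ :=
  (isPrimitive_ringEquiv_complex_iff Φ φ₀).2 ((pattern_primitive_iff_twistStabilizer_eq_bot Φ).2 hbot)

omit [IsCMField K] in
/-- The fibre of `Hom(K, ℂ) → Hom(F, ℂ)` over `φ₀|_F` is `{σ_s : s ∈ Gal(K/F)}`. [cite: Shimura1998, §8.4 Example (1)] -/
private theorem fibre_eq_image_nw (φ₀ : K →+* ℂ) (F : IntermediateField ℚ K) :
    (Finset.univ.filter fun φ : K →+* ℂ => φ.comp (algebraMap F K) = φ₀.comp (algebraMap F K)) =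
      (Finset.univ.filter fun s : K ≃ₐ[ℚ] K => s ∈ F.fixingSubgroup).image (embOf φ₀) := by
  ext φ
  simp only [Finset.mem_filter, Finset.mem_univ, true_and, Finset.mem_image]
  constructor
  · intro hφ
    obtain ⟨s, rfl⟩ := (embOf_bijective φ₀).2 φ
    exact ⟨s, (mem_fixingSubgroup_iff_embOf_comp_eq φ₀ F s).2 hφ, rfl⟩
  · rintro ⟨s, hs, rfl⟩
    exact (mem_fixingSubgroup_iff_embOf_comp_eq φ₀ F s).1 hs

/-- … and over the conjugate embedding it is `{σ_s : s ∉ Gal(K/F)}` (`F` imaginary quadratic).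
[cite: Shimura1998, §8.4 Example (1) and §18.2 Lemma (i)] -/
private theorem fibre_conj_eq_image_nw (hexp : ∀ g : K ≃ₐ[ℚ] K, g ^ 2 = 1) (φ₀ : K →+* ℂ)
    (F : IntermediateField ℚ K) (h2 : finrank ℚ F = 2) (hF : ¬ IsTotallyReal F) :
    (Finset.univ.filter fun φ : K →+* ℂ =>
        φ.comp (algebraMap F K) = ComplexEmbedding.conjugate (φ₀.comp (algebraMap F K))) =
      (Finset.univ.filter fun s : K ≃ₐ[ℚ] K => s ∉ F.fixingSubgroup).image (embOf φ₀) := by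
  haveI := Multiquadratic.isAbelianGalois_of_forall_sq_eq_one hexp
  ext φ
  simp only [Finset.mem_filter, Finset.mem_univ, true_and, Finset.mem_image]
  constructor
  · intro hφ
    obtain ⟨s, rfl⟩ := (embOf_bijective φ₀).2 φ
    exact ⟨s, (not_mem_fixingSubgroup_iff_embOf_comp_eq_conjugate φ₀ F h2 hF s).2 hφ, rfl⟩
  · rintro ⟨s, hs, rfl⟩
    exact (not_mem_fixingSubgroup_iff_embOf_comp_eq_conjugate φ₀ F h2 hF s).1 hs

omit [IsCMField K] in
/-- `|Gal(K/F)| = 32` for a quadratic subfield of a field of degree `64`. [cite: Shimura1998, §8.4 Example (1)] -/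
private theorem card_filter_mem_fixingSubgroup_nw (φ₀ : K →+* ℂ) (hK : finrank ℚ K = 64)
    (F : IntermediateField ℚ K) (h2 : finrank ℚ F = 2) :
    (Finset.univ.filter fun s : K ≃ₐ[ℚ] K => s ∈ F.fixingSubgroup).card = 32 := by
  have hidx := index_fixingSubgroup_eq_two F h2
  have hmul := F.fixingSubgroup.card_mul_index
  have hG : Nat.card (K ≃ₐ[ℚ] K) = 64 := by rw [Nat.card_eq_fintype_card, card_gal_eq_finrank φ₀, hK]
  rw [hidx, hG] at hmul
  have hH : Nat.card (F.fixingSubgroup) = 32 := by omega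
  rw [Nat.card_eq_fintype_card, Fintype.card_subtype] at hH
  convert hH

omit [IsCMField K] in
/-- … and its complement has `32` elements. [cite: Shimura1998, §8.4 Example (1)] -/
private theorem card_filter_not_mem_fixingSubgroup_nw (φ₀ : K →+* ℂ) (hK : finrank ℚ K = 64)
    (F : IntermediateField ℚ K) (h2 : finrank ℚ F = 2) :
    (Finset.univ.filter fun s : K ≃ₐ[ℚ] K => s ∉ F.fixingSubgroup).card = 32 := by
  have h := Finset.card_filter_add_card_filter_not (s := (Finset.univ : Finset (K ≃ₐ[ℚ] K)))
    (fun s : K ≃ₐ[ℚ] K => s ∈ F.fixingSubgroup)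
  rw [card_filter_mem_fixingSubgroup_nw φ₀ hK F h2, Finset.card_univ, card_gal_eq_finrank φ₀, hK] at h
  omega

/-- `φ₀|_F` is not real for an imaginary quadratic subfield `F` (`ρ ∉ Gal(K/F)`). [cite: Shimura1998, §18.2 Lemma (i)] -/
private theorem conjugate_comp_ne_nw (hexp : ∀ g : K ≃ₐ[ℚ] K, g ^ 2 = 1) (φ₀ : K →+* ℂ)
    (F : IntermediateField ℚ K) (h2 : finrank ℚ F = 2) (hF : ¬ IsTotallyReal F) :
    ComplexEmbedding.conjugate (φ₀.comp (algebraMap F K)) ≠ φ₀.comp (algebraMap F K) := by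
  haveI := Multiquadratic.isAbelianGalois_of_forall_sq_eq_one hexp
  have hρ : (conjGal : K ≃ₐ[ℚ] K) ∉ F.fixingSubgroup := (conjGal_not_mem_fixingSubgroup_iff F).2 hF
  intro h
  have h1 := (not_mem_fixingSubgroup_iff_embOf_comp_eq_conjugate φ₀ F h2 hF (conjGal : K ≃ₐ[ℚ] K)).1 hρ
  rw [h] at h1
  exact hρ ((mem_fixingSubgroup_iff_embOf_comp_eq φ₀ F (conjGal : K ≃ₐ[ℚ] K)).2 h1)

/-- **Balanced ⟹ multiplicity `16`**: if `Φ` is balanced over the imaginary quadratic `F ⊆ K` (`[K:ℚ] = 64`) then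
`m_{φ₀|F}(Φ) = 16` and `m_{φ̄₀|F}(Φ) = 16`. [cite: Dodson1984, §3.1.1 Theorem] [cite: Gordon1999HodgeAVSurvey, §9.2] -/
private theorem ncard_eq_sixteen_nw (hexp : ∀ g : K ≃ₐ[ℚ] K, g ^ 2 = 1) (φ₀ : K →+* ℂ) (Φ : CMType K)
    (hK : finrank ℚ K = 64) (F : IntermediateField ℚ K) (h2 : finrank ℚ F = 2) (hF : ¬ IsTotallyReal F)
    (hW : ∀ τ : F →+* ℂ, {φ : K →+* ℂ | φ.comp (algebraMap F K) = τ ∧ φ ∈ Φ.1}.ncard =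
      {φ : K →+* ℂ | φ.comp (algebraMap F K) = τ ∧ φ ∉ Φ.1}.ncard) :
    {φ : K →+* ℂ | φ.comp (algebraMap F K) = φ₀.comp (algebraMap F K) ∧ φ ∈ Φ.1}.ncard = 16 ∧
      {φ : K →+* ℂ | φ.comp (algebraMap F K) = ComplexEmbedding.conjugate (φ₀.comp (algebraMap F K)) ∧
        φ ∈ Φ.1}.ncard = 16 := by
  have e1 := card_fibre_eq_two_mul (algebraMap F K) hW (φ₀.comp (algebraMap F K))
  have e2 := card_fibre_eq_two_mul (algebraMap F K) hW (ComplexEmbedding.conjugate (φ₀.comp (algebraMap F K)))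
  rw [fibre_eq_image_nw φ₀ F, Finset.card_image_of_injective _ (embOf_bijective φ₀).1,
    card_filter_mem_fixingSubgroup_nw φ₀ hK F h2] at e1
  rw [fibre_conj_eq_image_nw hexp φ₀ F h2 hF, Finset.card_image_of_injective _ (embOf_bijective φ₀).1,
    card_filter_not_mem_fixingSubgroup_nw φ₀ hK F h2] at e2
  constructor <;> omega

end Helpers

/-! ## §1 A near-bent CM type is of Weil type over exactly `[K:ℚ]/4` imaginary quadratic subfields -/

section WeilCount

/-- **`4·#{F imaginary quadratic ⊆ K : Φ balanced over F} = [K:ℚ]` FOR A NEAR-BENT CM TYPE** of a multiquadratic CM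
field (`Rank(Φ) + #{…} = g + 1`, Dodson, and `Rank(Φ) = g/2 + 1`, Kubota/near-bent): `Φ` is of Weil type over exactly
half of its `g` imaginary quadratic subfields — those cut out by the odd characters with `Ŝ_Φ(χ) = 0` («the support of
their Walsh transform has cardinality `2ⁿ⁻¹`»). [cite: Dodson1984, §3.1.1 Theorem] [cite: Kubota1965, §4 Lemma 2]
[cite: Carlet2020, §6.2.4] -/
theorem four_mul_ncard_weilQuadratic_eq_of_nearBent (hexp : ∀ g : K ≃ₐ[ℚ] K, g ^ 2 = 1)
    (φ₀ : K →+* ℂ) (Φ : CMType K)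
    (hnb : ∀ χ : AddChar (Additive (K ≃ₐ[ℚ] K)) ℂ, χ (Additive.ofMul (conjGal : K ≃ₐ[ℚ] K)) = -1 →
      ∑ s ∈ (Finset.univ.filter fun s : K ≃ₐ[ℚ] K => embOf φ₀ s ∈ Φ.1), χ (Additive.ofMul s) = 0 ∨
        (∑ s ∈ (Finset.univ.filter fun s : K ≃ₐ[ℚ] K => embOf φ₀ s ∈ Φ.1), χ (Additive.ofMul s)) ^ 2 =
          2 * ((Finset.univ.filter fun s : K ≃ₐ[ℚ] K => embOf φ₀ s ∈ Φ.1).card : ℂ)) :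
    4 * {F : IntermediateField ℚ K | finrank ℚ F = 2 ∧ ¬ IsTotallyReal F ∧
        ∀ τ : F →+* ℂ, {φ : K →+* ℂ | φ.comp (algebraMap F K) = τ ∧ φ ∈ Φ.1}.ncard =
          {φ : K →+* ℂ | φ.comp (algebraMap F K) = τ ∧ φ ∉ Φ.1}.ncard}.ncard = finrank ℚ K := by
  have h1 := Multiquadratic.cmTypeRank_add_ncard_weilQuadratic_eq hexp Φ
  have h2 := four_mul_cmTypeRank_sub_one_eq hexp φ₀ Φ hnb
  have hpos : 0 < finrank ℚ K := finrank_pos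
  omega

/-- **DEGREE `64`: A NEAR-BENT CM TYPE IS OF WEIL TYPE OVER EXACTLY `16` OF ITS `32` IMAGINARY QUADRATIC SUBFIELDS.**
[cite: Dodson1984, §3.1.1 Theorem] [cite: Kubota1965, §4 Lemma 2] [cite: Carlet2020, §6.2.4] -/
theorem ncard_weilQuadratic_eq_sixteen_of_nearBent (hexp : ∀ g : K ≃ₐ[ℚ] K, g ^ 2 = 1) (φ₀ : K →+* ℂ)
    (Φ : CMType K) (hK : finrank ℚ K = 64)
    (hnb : ∀ χ : AddChar (Additive (K ≃ₐ[ℚ] K)) ℂ, χ (Additive.ofMul (conjGal : K ≃ₐ[ℚ] K)) = -1 →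
      ∑ s ∈ (Finset.univ.filter fun s : K ≃ₐ[ℚ] K => embOf φ₀ s ∈ Φ.1), χ (Additive.ofMul s) = 0 ∨
        (∑ s ∈ (Finset.univ.filter fun s : K ≃ₐ[ℚ] K => embOf φ₀ s ∈ Φ.1), χ (Additive.ofMul s)) ^ 2 =
          2 * ((Finset.univ.filter fun s : K ≃ₐ[ℚ] K => embOf φ₀ s ∈ Φ.1).card : ℂ)) :
    {F : IntermediateField ℚ K | finrank ℚ F = 2 ∧ ¬ IsTotallyReal F ∧
        ∀ τ : F →+* ℂ, {φ : K →+* ℂ | φ.comp (algebraMap F K) = τ ∧ φ ∈ Φ.1}.ncard =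
          {φ : K →+* ℂ | φ.comp (algebraMap F K) = τ ∧ φ ∉ Φ.1}.ncard}.ncard = 16 := by
  have h := four_mul_ncard_weilQuadratic_eq_of_nearBent hexp φ₀ Φ hnb
  rw [hK] at h
  omega

end WeilCount

/-! ## §2 The primitive case: `32` exceptional Weil lines in `H^{16,16}` -/

section WeilLines

/-- **`dim B¹⁶(A) − dim D¹⁶(A) ≥ 32` FOR EVERY REALISATION OF A PRIMITIVE NEAR-BENT TYPE OF DEGREE `64`.**  The `16`
Weil subfields `F` of `Φ` and their two embeddings give `32` pairwise distinct fibres `Δ_{F,τ} = {φ : φ|_F = τ}`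
(`= σ(Gal(K/F))` resp. its complement, `|Δ| = 32 = 2·16`), each a Pohlmann set of degree `16` (a Hodge weight: the
Weil classes of `(A, F)`) which is not a Pohlmann divisor set (`Φ` primitive, `τ` non-real); White's count
`dim Bᵐ − dim Dᵐ = #(pohlmannSets ∖ pohlmannDivisorSets)` finishes. [cite: Gordon1999HodgeAVSurvey, 9.2.2 and 5.13 (ii)]
[cite: Pohlmann1968, Thm. 1] [cite: vanGeemen1994HodgeAV, 4.7] -/
theorem le_finrank_hodgeClassSpan_sub_finrank_divisorClassesSpan_of_nearBent (hexp : ∀ g : K ≃ₐ[ℚ] K, g ^ 2 = 1)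
    (φ₀ : K →+* ℂ) (Φ : CMType K) (hK : finrank ℚ K = 64)
    (hnb : ∀ χ : AddChar (Additive (K ≃ₐ[ℚ] K)) ℂ, χ (Additive.ofMul (conjGal : K ≃ₐ[ℚ] K)) = -1 →
      ∑ s ∈ (Finset.univ.filter fun s : K ≃ₐ[ℚ] K => embOf φ₀ s ∈ Φ.1), χ (Additive.ofMul s) = 0 ∨
        (∑ s ∈ (Finset.univ.filter fun s : K ≃ₐ[ℚ] K => embOf φ₀ s ∈ Φ.1), χ (Additive.ofMul s)) ^ 2 =
          2 * ((Finset.univ.filter fun s : K ≃ₐ[ℚ] K => embOf φ₀ s ∈ Φ.1).card : ℂ))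
    (hbot : twistStabilizer Φ = ⊥) (hA : IsCMTypeRealisation Φ A ι θ) :
    32 ≤ Module.finrank ℂ ↥(hodgeClassSpan (finrank ℚ K / 2) A.X 16) -
        Module.finrank ℂ ↥(divisorClassesSpan A.X (finrank ℚ K / 2) 16) := by
  rw [finrank_hodgeClassSpan_sub_finrank_divisorClassesSpan hA 16]
  have hprim : IsPrimitive (ℂ ≃+* ℂ) Φ.1 φ₀ := isPrimitive_of_bot_nw Φ hbot φ₀
  -- the `16` Weil subfields
  have hW16 := ncard_weilQuadratic_eq_sixteen_of_nearBent hexp φ₀ Φ hK hnb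
  set W := {F : IntermediateField ℚ K | finrank ℚ F = 2 ∧ ¬ IsTotallyReal F ∧
      ∀ τ : F →+* ℂ, {φ : K →+* ℂ | φ.comp (algebraMap F K) = τ ∧ φ ∈ Φ.1}.ncard =
        {φ : K →+* ℂ | φ.comp (algebraMap F K) = τ ∧ φ ∉ Φ.1}.ncard} with hWdef
  -- the two families of fibres
  set f₁ : IntermediateField ℚ K → Finset (K →+* ℂ) := fun F =>
    Finset.univ.filter fun φ : K →+* ℂ => φ.comp (algebraMap F K) = φ₀.comp (algebraMap F K) with hf₁
  set f₂ : IntermediateField ℚ K → Finset (K →+* ℂ) := fun F =>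
    Finset.univ.filter fun φ : K →+* ℂ =>
      φ.comp (algebraMap F K) = ComplexEmbedding.conjugate (φ₀.comp (algebraMap F K)) with hf₂
  -- both land in the exceptional Pohlmann sets of degree `16`
  have hmem₁ : ∀ F ∈ W, f₁ F ∈ pohlmannSets Φ 16 \ pohlmannDivisorSets Φ 16 := by
    intro F hF
    obtain ⟨h2, hFr, hW⟩ := hF
    have h := fibre_mem_pohlmannSets_diff (algebraMap F K) φ₀ hprim hW (conjugate_comp_ne_nw hexp φ₀ F h2 hFr)
    rwa [(ncard_eq_sixteen_nw hexp φ₀ Φ hK F h2 hFr hW).1] at h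
  have hmem₂ : ∀ F ∈ W, f₂ F ∈ pohlmannSets Φ 16 \ pohlmannDivisorSets Φ 16 := by
    intro F hF
    obtain ⟨h2, hFr, hW⟩ := hF
    have hne : ComplexEmbedding.conjugate (ComplexEmbedding.conjugate (φ₀.comp (algebraMap F K))) ≠
        ComplexEmbedding.conjugate (φ₀.comp (algebraMap F K)) := by
      rw [ComplexEmbedding.involutive_conjugate (↥F) (φ₀.comp (algebraMap F K))]
      exact (conjugate_comp_ne_nw hexp φ₀ F h2 hFr).symm
    have h := fibre_mem_pohlmannSets_diff (algebraMap F K) φ₀ hprim hW hne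
    rwa [(ncard_eq_sixteen_nw hexp φ₀ Φ hK F h2 hFr hW).2] at h
  -- injectivity: the fibre determines `Gal(K/F)`, hence `F`
  have hinj₁ : Set.InjOn f₁ W := by
    intro F hF F' hF' hFF'
    have h : F.fixingSubgroup = F'.fixingSubgroup := by
      ext s
      have e : (Finset.univ.filter fun s : K ≃ₐ[ℚ] K => s ∈ F.fixingSubgroup) =
          Finset.univ.filter fun s : K ≃ₐ[ℚ] K => s ∈ F'.fixingSubgroup := by
        rw [← Finset.image_inj (f := embOf φ₀) (embOf_bijective φ₀).1, ← fibre_eq_image_nw φ₀ F,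
          ← fibre_eq_image_nw φ₀ F']
        exact hFF'
      have := Finset.ext_iff.1 e s
      simpa using this
    rw [← IsGalois.fixedField_fixingSubgroup F, ← IsGalois.fixedField_fixingSubgroup F', h]
  have hinj₂ : Set.InjOn f₂ W := by
    intro F hF F' hF' hFF'
    have h : F.fixingSubgroup = F'.fixingSubgroup := by
      ext s
      have e : (Finset.univ.filter fun s : K ≃ₐ[ℚ] K => s ∉ F.fixingSubgroup) =
          Finset.univ.filter fun s : K ≃ₐ[ℚ] K => s ∉ F'.fixingSubgroup := by
        rw [← Finset.image_inj (f := embOf φ₀) (embOf_bijective φ₀).1,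
          ← fibre_conj_eq_image_nw hexp φ₀ F hF.1 hF.2.1, ← fibre_conj_eq_image_nw hexp φ₀ F' hF'.1 hF'.2.1]
        exact hFF'
      have := Finset.ext_iff.1 e s
      simp only [Finset.mem_filter, Finset.mem_univ, true_and] at this
      tauto
    rw [← IsGalois.fixedField_fixingSubgroup F, ← IsGalois.fixedField_fixingSubgroup F', h]
  -- disjointness: `φ₀ ∈ f₁ F`, `φ₀ ∉ f₂ F'`
  have hdisj : Disjoint (f₁ '' W) (f₂ '' W) := by
    rw [Set.disjoint_left]
    rintro Δ ⟨F, -, rfl⟩ ⟨F', hF', hFF'⟩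
    have hφ₀ : φ₀ ∈ f₁ F := by
      simp only [hf₁, Finset.mem_filter, Finset.mem_univ, true_and]
    rw [← hFF'] at hφ₀
    simp only [hf₂, Finset.mem_filter, Finset.mem_univ, true_and] at hφ₀
    exact conjugate_comp_ne_nw hexp φ₀ F' hF'.1 hF'.2.1 hφ₀.symm
  -- count
  have hsub : f₁ '' W ∪ f₂ '' W ⊆ pohlmannSets Φ 16 \ pohlmannDivisorSets Φ 16 := by
    rintro Δ (⟨F, hF, rfl⟩ | ⟨F, hF, rfl⟩)
    · exact hmem₁ F hF
    · exact hmem₂ F hF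
  calc 32 = W.ncard + W.ncard := by rw [hW16]
    _ = (f₁ '' W).ncard + (f₂ '' W).ncard := by rw [hinj₁.ncard_image, hinj₂.ncard_image]
    _ = (f₁ '' W ∪ f₂ '' W).ncard := (Set.ncard_union_eq hdisj (Set.toFinite _) (Set.toFinite _)).symm
    _ ≤ (pohlmannSets Φ 16 \ pohlmannDivisorSets Φ 16).ncard := Set.ncard_le_ncard hsub (Set.toFinite _)

/-- **AN EXCEPTIONAL `(16,16)`-CLASS**: every realisation of a primitive near-bent type of degree `64` carries a rational
class of Hodge type `(16, 16)` — in the middle cohomology `H³²(A)` — outside `D¹⁶(A) ⊗ ℂ`: the Weil class of any of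
its `16` Weil subfields. [cite: Gordon1999HodgeAVSurvey, 5.13 (ii) and 9.2.2] [cite: vanGeemen1994HodgeAV, Thm. 4.5 and 4.7]
[cite: Pohlmann1968, Thm. 1] -/
theorem exists_exceptional_sixteen_of_nearBent (hexp : ∀ g : K ≃ₐ[ℚ] K, g ^ 2 = 1) (φ₀ : K →+* ℂ) (Φ : CMType K)
    (hK : finrank ℚ K = 64)
    (hnb : ∀ χ : AddChar (Additive (K ≃ₐ[ℚ] K)) ℂ, χ (Additive.ofMul (conjGal : K ≃ₐ[ℚ] K)) = -1 →
      ∑ s ∈ (Finset.univ.filter fun s : K ≃ₐ[ℚ] K => embOf φ₀ s ∈ Φ.1), χ (Additive.ofMul s) = 0 ∨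
        (∑ s ∈ (Finset.univ.filter fun s : K ≃ₐ[ℚ] K => embOf φ₀ s ∈ Φ.1), χ (Additive.ofMul s)) ^ 2 =
          2 * ((Finset.univ.filter fun s : K ≃ₐ[ℚ] K => embOf φ₀ s ∈ Φ.1).card : ℂ))
    (hbot : twistStabilizer Φ = ⊥) (hA : IsCMTypeRealisation Φ A ι θ) :
    ∃ c : complexBetti A.X (2 * 16), IsRationalClass c ∧
      IsOfHodgeType (finrank ℚ K / 2) A.X (2 * 16) 16 16 c ∧ c ∉ divisorClassesSpan A.X (finrank ℚ K / 2) 16 := by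
  have hprim : IsPrimitive (ℂ ≃+* ℂ) Φ.1 φ₀ := isPrimitive_of_bot_nw Φ hbot φ₀
  -- a Weil subfield exists (`16 > 0` of them)
  have hW16 := ncard_weilQuadratic_eq_sixteen_of_nearBent hexp φ₀ Φ hK hnb
  obtain ⟨F, h2, hFr, hW⟩ := Set.nonempty_of_ncard_ne_zero (by rw [hW16]; norm_num)
  have h := exists_exceptional_of_fibres_balanced (algebraMap F K) φ₀ hprim hW
    (conjugate_comp_ne_nw hexp φ₀ F h2 hFr) hA
  rwa [(ncard_eq_sixteen_nw hexp φ₀ Φ hK F h2 hFr hW).1] at h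

end WeilLines

/-! ## §3 Existence on every multiquadratic CM field of degree `64` -/

section Existence

/-- **EVERY MULTIQUADRATIC CM FIELD OF DEGREE `64` HAS A CM TYPE WHOSE ABELIAN VARIETIES ARE SIMPLE `32`-FOLDS OF WEIL
TYPE OVER EXACTLY `16` IMAGINARY QUADRATIC SUBFIELDS WITH `dim B¹⁶ − dim D¹⁶ ≥ 32`** (the primitive near-bent type of
g45-#6), carrying an exceptional rational `(16,16)`-class. [cite: Gordon1999HodgeAVSurvey, 5.13 (ii), 9.2.2 and §9.3]
[cite: Pohlmann1968, Thm. 1] [cite: Carlet2020, §7.1.9 II and §6.2.4] -/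
theorem exists_isSimple_weil_exceptional_of_finrank_eq_sixtyFour (hexp : ∀ g : K ≃ₐ[ℚ] K, g ^ 2 = 1)
    (φ₀ : K →+* ℂ) (hK : finrank ℚ K = 64) :
    ∃ Φ : CMType K, twistStabilizer Φ = ⊥ ∧ cmTypeRank Φ = 17 ∧
      {F : IntermediateField ℚ K | finrank ℚ F = 2 ∧ ¬ IsTotallyReal F ∧
        ∀ τ : F →+* ℂ, {φ : K →+* ℂ | φ.comp (algebraMap F K) = τ ∧ φ ∈ Φ.1}.ncard =
          {φ : K →+* ℂ | φ.comp (algebraMap F K) = τ ∧ φ ∉ Φ.1}.ncard}.ncard = 16 ∧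
      ∀ (A : AbelianVariety ℂ) (ι : 𝓞 K →+* End A) (θ : K →+* Module.End ℂ (complexBetti A.X 1)),
        IsCMTypeRealisation Φ A ι θ →
          A.IsSimple ∧ A.dim = 32 ∧
            32 ≤ Module.finrank ℂ ↥(hodgeClassSpan (finrank ℚ K / 2) A.X 16) -
              Module.finrank ℂ ↥(divisorClassesSpan A.X (finrank ℚ K / 2) 16) ∧
            ∃ c : complexBetti A.X (2 * 16), IsRationalClass c ∧
              IsOfHodgeType (finrank ℚ K / 2) A.X (2 * 16) 16 16 c ∧
              c ∉ divisorClassesSpan A.X (finrank ℚ K / 2) 16 := by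
  obtain ⟨Φ, hnb, h1, hbot⟩ := exists_nearBent_natCard_twistStabilizer_eq_one_of_finrank_eq_sixtyFour hexp φ₀ hK
  refine ⟨Φ, hbot, cmTypeRank_eq_seventeen_of_finrank_eq_sixtyFour hexp φ₀ Φ hK hnb,
    ncard_weilQuadratic_eq_sixteen_of_nearBent hexp φ₀ Φ hK hnb, fun A ι θ hA => ?_⟩
  obtain ⟨hS, -, -⟩ := isSimple_and_exists_exceptional_of_natCard_twistStabilizer_eq_one hexp φ₀ Φ hnb h1 hA
  have hdim : A.dim = finrank ℚ K / 2 := Literature.AlgebraicGeometry.Motives.schemeDim_eq_holds hA.1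
  exact ⟨hS, by rw [hdim, hK],
    le_finrank_hodgeClassSpan_sub_finrank_divisorClassesSpan_of_nearBent hexp φ₀ Φ hK hnb hbot hA,
    exists_exceptional_sixteen_of_nearBent hexp φ₀ Φ hK hnb hbot hA⟩

/-- **… and such abelian varieties exist** (Shimura §6.2 Thm. 3, tree `exists_isCMTypeRealisation`): a SIMPLE
abelian `32`-fold with multiquadratic complex multiplication and at least `32` independent exceptional Weil lines in
`H^{16,16}`. [cite: Shimura1998, §6.2 Thm. 3] [cite: Gordon1999HodgeAVSurvey, 9.2.2 and §9.3] -/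
theorem exists_isSimple_thirtyTwofold_weilLines_of_finrank_eq_sixtyFour (hexp : ∀ g : K ≃ₐ[ℚ] K, g ^ 2 = 1)
    (φ₀ : K →+* ℂ) (hK : finrank ℚ K = 64) :
    ∃ (Φ : CMType K) (A : AbelianVariety ℂ) (ι : 𝓞 K →+* End A) (θ : K →+* Module.End ℂ (complexBetti A.X 1)),
      IsCMTypeRealisation Φ A ι θ ∧ A.IsSimple ∧ A.dim = 32 ∧
        32 ≤ Module.finrank ℂ ↥(hodgeClassSpan (finrank ℚ K / 2) A.X 16) -
          Module.finrank ℂ ↥(divisorClassesSpan A.X (finrank ℚ K / 2) 16) := by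
  obtain ⟨Φ, -, -, -, hall⟩ := exists_isSimple_weil_exceptional_of_finrank_eq_sixtyFour hexp φ₀ hK
  obtain ⟨A, ι, θ, hA⟩ := exists_isCMTypeRealisation Φ
  obtain ⟨hS, hd, hle, -⟩ := hall A ι θ hA
  exact ⟨Φ, A, ι, θ, hA, hS, hd, hle⟩

end Existence

end MultiquadraticNearBentWeil

end Literature.AlgebraicGeometry.Pohlmann1968
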